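import Mathlib
import Summits.PneNP.PneNP.Theorems.Nc03AvoidResidualCoreReductionSolveC
import Summits.PneNP.PneNP.Theorems.Nc03AvoidResidualCoreReductionSolveB
import Summits.PneNP.PneNP.Theorems.Nc03AvoidResidualCoreReductionLinB

/-!
# Route Nc03AvoidResidualCore, item `ResidualCoreReduction` — the solver, VIII: classes `9`, `11`

Helper file for `stmt-PneNP-20227` (sequel of `…ReductionSolveC`; cell pnp-ideate). Polynomial time
solvers for class `9` (`a ∧ (b ⊕ c)`: first head-occurrences switched on, plus the first non-first
output whose tail-row depends on earlier non-first tail-rows) and class `11` (exactly-one: two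
dependent outputs covering two roles of a third; the two dependent outputs switched off).
Correctness via `cert9_exists/sound` (`…LinA`) and `cert11_exists/sound`, `row7_mem_span_of_dep`
(`…LinB`); polynomial time via the span test and context-carrying searches.
-/

set_option linter.dupNamespace false -- `Summit.PneNP.PneNP.…`: summit = sub-problem name (D-0017 single-conjunct layout)

namespace Summit.PneNP.PneNP.Theorems.Nc03Reduction

open Literature.Computability.Complexity CodeFP

variable {N M : ℕ}

/-! ## Class 9 -/

/-- An output is a first occurrence of its head: no earlier output has the same head. -/
def isFirstL (pr : PRaw) (x : ETrip) : Bool :=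
  !((enumT pr).any fun f => decide (f.1 < x.1) && decide (f.2.1 = x.2.1))

/-- The tail-rows of the earlier non-first outputs. -/
def rows9NF (pr : PRaw) (k : ℕ) : List (List ℕ) :=
  ((enumT pr).filter fun f => decide (f.1 < k) && !isFirstL pr f).map fun f => r9 f.2

/-- Test, class `9`: a non-first output whose tail-row depends on earlier non-first tail-rows. -/
def test9 (q : PRaw × ETrip) : Bool :=
  !isFirstL q.1 q.2 && inSpan q.1.1 (rows9NF q.1 q.2.1) (r9 q.2.2)

/-- Output, class `9`: first occurrences and the found output switched on. -/
def out9 (pr : PRaw) (o : Option ETrip) : List Bool :=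
  match o with
  | none => indic pr.2.1 []
  | some x => (enumT pr).map fun f => isFirstL pr f || decide (f.1 = x.1)

/-- Solver, class `9`. -/
def sol9 (pr : PRaw) : List Bool := out9 pr ((enumT pr).find? fun x => test9 (pr, x))

/-- Length of the enumeration. -/
theorem length_enumT_rawOf (J : LocalMap 3 N M) : (enumT (rawOf J)).length = M := by
  simp [enumT, rawOf_eq]

/-- Output length, class `9`. -/
theorem length_sol9 (J : LocalMap 3 N M) : (sol9 (rawOf J)).length = M := by
  unfold sol9 out9; split
  · simp
  · rw [List.length_map, length_enumT_rawOf]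

/-- Reading `isFirstL` on a genuine instance: membership in `firsts`. -/
theorem isFirstL_iff (J : LocalMap 3 N M) (p : Fin M) :
    isFirstL (rawOf J) (p.val, tripOf J p) = true ↔ p ∈ firsts J := by
  rw [mem_firsts]
  unfold isFirstL
  rw [Bool.not_eq_true', Bool.eq_false_iff, ne_eq, List.any_eq_true]
  simp only [Bool.and_eq_true, decide_eq_true_eq, not_exists, not_and, tripOf_fst]
  constructor
  · intro h j hj heq
    exact h (j.val, tripOf J j) (mem_enumT J j) hj (by rw [tripOf_fst]; exact congrArg Fin.val heq)
  · intro h f hf hlt heq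
    obtain ⟨j, rfl⟩ := (mem_enumT_iff J).1 hf
    exact h j hlt (Fin.ext (by rw [tripOf_fst] at heq; exact heq))

/-- The earlier non-first tail-rows, as vectors. -/
theorem vecL_image_rows9NF (J : LocalMap 3 N M) (k : Fin M) :
    vecL N '' {x | x ∈ rows9NF (rawOf J) k.val} = row9 J '' {j : Fin M | j < k ∧ j ∉ firsts J} := by
  ext v
  simp only [rows9NF, Set.mem_image, Set.mem_setOf_eq, List.mem_map, List.mem_filter, Bool.and_eq_true,
    decide_eq_true_eq, Bool.not_eq_true']
  constructor
  · rintro ⟨x, ⟨f, ⟨hf, hlt, hnf⟩, rfl⟩, rfl⟩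
    obtain ⟨j, rfl⟩ := (mem_enumT_iff J).1 hf
    refine ⟨j, ⟨hlt, fun hj => ?_⟩, (vecL_r9 J j).symm⟩
    rw [← isFirstL_iff] at hj; rw [hj] at hnf; exact Bool.noConfusion hnf
  · rintro ⟨j, ⟨hlt, hnf⟩, rfl⟩
    refine ⟨r9 (tripOf J j), ⟨(j.val, tripOf J j), ⟨mem_enumT J j, hlt, ?_⟩, rfl⟩, vecL_r9 J j⟩
    rw [← isFirstL_iff] at hnf
    cases h : isFirstL (rawOf J) (j.val, tripOf J j)
    · rfl
    · exact absurd h hnf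

/-- Reading the class-`9` test on a genuine instance. -/
theorem test9_iff (J : LocalMap 3 N M) (k : Fin M) :
    test9 (rawOf J, (k.val, tripOf J k)) = true ↔
      k ∉ firsts J ∧ row9 J k ∈ Submodule.span (ZMod 2) (row9 J '' {j | j < k ∧ j ∉ firsts J}) := by
  unfold test9
  rw [Bool.and_eq_true, Bool.not_eq_true', inSpan_iff, rawOf_N, vecL_image_rows9NF, vecL_r9,
    ← isFirstL_iff, Bool.eq_false_iff]

/-- Correctness, class `9`. -/
theorem sol9_correct (J : LocalMap 3 N M) (hP : J.IsPure (rep 9)) (hM : 2 * N < M) :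
    (fun p : Fin M => (sol9 (rawOf J)).getD p.val false) ∉ J.range := by
  obtain ⟨k, hk, hdep⟩ := cert9_exists J hM
  have hx₀ := (test9_iff J k).2 ⟨hk, hdep⟩
  cases h : (enumT (rawOf J)).find? (fun x => test9 (rawOf J, x)) with
  | none => exact absurd hx₀ (by have := List.find?_eq_none.1 h _ (mem_enumT J k); simpa using this)
  | some x =>
    have hx := List.find?_some h
    obtain ⟨p, rfl⟩ := (mem_enumT_iff J).1 (List.mem_of_find?_eq_some h)
    obtain ⟨hp, hdep'⟩ := (test9_iff J p).1 hx
    have hsol : sol9 (rawOf J) = (enumT (rawOf J)).map fun f => isFirstL (rawOf J) f || decide (f.1 = p.val) := by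
      unfold sol9 out9; rw [h]
    refine cert9_sound hP p hdep' fun j => ?_
    show (sol9 (rawOf J)).getD j.val false = true ↔ _
    rw [hsol, List.getD_eq_getElem?_getD, List.getElem?_map]
    have hj : (enumT (rawOf J))[j.val]? = some (j.val, tripOf J j) := by
      unfold enumT; rw [rawOf_eq]
      simp only
      rw [List.getElem?_zip_eq_some]
      refine ⟨List.getElem?_range (by rw [List.length_ofFn]; exact j.isLt), ?_⟩
      rw [List.getElem?_ofFn]; simp [j.isLt]
    rw [hj]
    simp only [Option.map_some, Option.getD_some, Bool.or_eq_true, decide_eq_true_eq]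
    rw [isFirstL_iff, Fin.ext_iff]

/-- `isFirstL` is polynomial time. -/
theorem codeFP_isFirstL : CodeFP (pairE prE etE) bitE (fun q => isFirstL q.1 q.2) := by
  have hp : CodeFP (pairE etE etE) bitE (fun t => decide (t.2.1 < t.1.1) && decide (t.2.2.1 = t.1.2.1)) :=
    ((natLt.comp ((snd _ _).fst'.pair (fst _ _).fst')).and
      (codeFP_eqTest (snd _ _).snd'.fst' (fst _ _).snd'.fst')).congr fun _ => rfl
  exact (((any hp).comp ((snd _ _).pair (codeFP_enumT.comp (fst _ _)))).not).congr fun _ => rfl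

/-- `rows9NF` is polynomial time. -/
theorem codeFP_rows9NF : CodeFP (pairE prE natE) (rawE (rawE natE)) (fun q => rows9NF q.1 q.2) := by
  have hp : CodeFP (pairE (pairE prE natE) etE) bitE
      (fun t => decide (t.2.1 < t.1.2) && !isFirstL t.1.1 t.2) :=
    ((natLt.comp ((snd _ _).fst'.pair (fst _ _).snd')).and
      (codeFP_isFirstL.comp ((fst _ _).fst'.pair (snd _ _))).not).congr fun _ => rfl
  have hf := (filter hp).comp ((CodeFP.id _).pair (codeFP_enumT.comp (fst _ _)))
  exact ((map₀ (codeFP_r9.comp (snd natE tripE))).comp hf).congr fun _ => rfl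

/-- Polynomial time, class `9`. -/
theorem codeFP_sol9 : CodeFP prE (rawE bitE) sol9 := by
  have ht : CodeFP (pairE prE etE) bitE test9 :=
    (codeFP_isFirstL.not.and (codeFP_inSpan.comp ((fst _ _).fst'.pair
      ((codeFP_rows9NF.comp ((fst _ _).pair (snd _ _).fst')).pair (codeFP_r9.comp (snd _ _).snd'))))).congr
      fun _ => rfl
  have hfind : CodeFP prE (optE etE) (fun pr => (enumT pr).find? fun x => test9 (pr, x)) :=
    ((rawFind? (σ := PRaw) (eσ := prE) (p := test9) ht).comp ((CodeFP.id prE).pair codeFP_enumT)).congr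
      fun _ => rfl
  have hitem : CodeFP (pairE (pairE prE etE) etE) bitE
      (fun t => isFirstL t.1.1 t.2 || decide (t.2.1 = t.1.2.1)) :=
    ((codeFP_isFirstL.comp ((fst _ _).fst'.pair (snd _ _))).or
      (codeFP_eqTest (snd _ _).fst' (fst _ _).snd'.fst')).congr fun _ => rfl
  have hsome : CodeFP (pairE prE etE) (rawE bitE)
      (fun q => (enumT q.1).map fun f => isFirstL q.1 f || decide (f.1 = q.2.1)) :=
    ((map hitem).comp ((CodeFP.id _).pair (codeFP_enumT.comp (fst _ _)))).congr fun _ => rfl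
  have hk := optCases (σ := PRaw) (eσ := prE) (eα := etE) (eδ := rawE bitE) (k := fun pr o => out9 pr o)
    (gnone := fun pr => indic pr.2.1 [])
    (gsome := fun q => (enumT q.1).map fun f => isFirstL q.1 f || decide (f.1 = q.2.1))
    (codeFP_indic.comp (codeFP_M.pair (const prE ([] : List ℕ)))) hsome (fun _ => rfl) (fun _ _ => rfl)
  exact (hk.comp ((CodeFP.id prE).pair hfind)).congr fun pr => by unfold sol9; rfl

/-! ## Class 11 -/

/-- The coordinate of role `r` of an enumerated triple. -/
def coordL (x : ETrip) (r : ℕ) : ℕ := if r = 0 then x.2.1 else if r = 1 then x.2.2.1 else x.2.2.2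

/-- Roles test, class `11`: two distinct roles of `e` covered by `fp` and `fq` respectively. -/
def roles11 (e fp fq : ETrip) : Bool :=
  (memb3 (coordL e 0, fp) && memb3 (coordL e 1, fq)) || (memb3 (coordL e 0, fp) && memb3 (coordL e 2, fq)) ||
  (memb3 (coordL e 1, fp) && memb3 (coordL e 0, fq)) || (memb3 (coordL e 1, fp) && memb3 (coordL e 2, fq)) ||
  (memb3 (coordL e 2, fp) && memb3 (coordL e 0, fq)) || (memb3 (coordL e 2, fp) && memb3 (coordL e 1, fq))

/-- Test, class `11`, on `(e, fp, fq)`. -/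
def test11 (q : PRaw × ETrip × ETrip × ETrip) : Bool :=
  !decide (q.2.2.1.1 = q.2.1.1) && !decide (q.2.2.2.1 = q.2.1.1) &&
    (testPS r7 (q.1, q.2.2.1) && testPS r7 (q.1, q.2.2.2)) && roles11 q.2.1 q.2.2.1 q.2.2.2

/-- Solver, class `11`: the two dependent outputs switched off. -/
def sol11 (pr : PRaw) : List Bool :=
  cosearchOut pr.2.1 ((((enumT pr).product ((enumT pr).product (enumT pr))).find?
    fun x => test11 (pr, x)).map fun x => [x.2.1.1, x.2.2.1])

/-- Output length, class `11`. -/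
@[simp] theorem length_sol11 (pr : PRaw) : (sol11 pr).length = pr.2.1 := by unfold sol11; simp

/-- Coordinates of genuine triples. -/
theorem coordL_tripOf (J : LocalMap 3 N M) (p : Fin M) (r : Fin 3) :
    coordL (p.val, tripOf J p) r.val = (J.vars p r).val := by
  fin_cases r <;> rfl

/-- Reading the roles test on genuine triples. -/
theorem roles11_iff (J : LocalMap 3 N M) (e fp fq : Fin M) :
    roles11 (e.val, tripOf J e) (fp.val, tripOf J fp) (fq.val, tripOf J fq) = true ↔
      ∃ rp rq : Fin 3, rp ≠ rq ∧ J.vars e rp ∈ rd3 J fp ∧ J.vars e rq ∈ rd3 J fq := by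
  have key : ∀ r : Fin 3, ∀ f : Fin M, memb3 (coordL (e.val, tripOf J e) r.val, (f.val, tripOf J f)) = true ↔
      J.vars e r ∈ rd3 J f := by
    intro r f; rw [coordL_tripOf]; exact memb3_iff J
  have k0p := key 0 fp; have k1p := key 1 fp; have k2p := key 2 fp
  have k0q := key 0 fq; have k1q := key 1 fq; have k2q := key 2 fq
  simp only [Fin.val_zero, Fin.val_one, Fin.val_two] at k0p k1p k2p k0q k1q k2q
  unfold roles11
  simp only [Bool.or_eq_true, Bool.and_eq_true, k0p, k1p, k2p, k0q, k1q, k2q]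
  constructor
  · rintro (((((⟨a, b⟩ | ⟨a, b⟩) | ⟨a, b⟩) | ⟨a, b⟩) | ⟨a, b⟩) | ⟨a, b⟩)
    · exact ⟨0, 1, by decide, a, b⟩
    · exact ⟨0, 2, by decide, a, b⟩
    · exact ⟨1, 0, by decide, a, b⟩
    · exact ⟨1, 2, by decide, a, b⟩
    · exact ⟨2, 0, by decide, a, b⟩
    · exact ⟨2, 1, by decide, a, b⟩
  · rintro ⟨rp, rq, hne, a, b⟩
    fin_cases rp <;> fin_cases rq <;> simp_all

/-- Reading the class-`11` test on genuine triples. -/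
theorem test11_iff (J : LocalMap 3 N M) (e fp fq : Fin M) :
    test11 (rawOf J, (e.val, tripOf J e), (fp.val, tripOf J fp), (fq.val, tripOf J fq)) = true ↔
      fp ≠ e ∧ fq ≠ e ∧ fp ∈ dep7 J ∧ fq ∈ dep7 J ∧
        ∃ rp rq : Fin 3, rp ≠ rq ∧ J.vars e rp ∈ rd3 J fp ∧ J.vars e rq ∈ rd3 J fq := by
  unfold test11
  simp only [Bool.and_eq_true, Bool.not_eq_true', decide_eq_false_iff_not]
  rw [testPS_iff J r7 (row7 J) (vecL_r7 J) fp, testPS_iff J r7 (row7 J) (vecL_r7 J) fq, roles11_iff,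
    mem_dep7, mem_dep7]
  constructor
  · rintro ⟨⟨⟨h1, h2⟩, h3, h4⟩, h5⟩
    exact ⟨fun h => h1 (congrArg Fin.val h), fun h => h2 (congrArg Fin.val h), h3, h4, h5⟩
  · rintro ⟨h1, h2, h3, h4, h5⟩
    exact ⟨⟨⟨fun h => h1 (Fin.ext h), fun h => h2 (Fin.ext h)⟩, h3, h4⟩, h5⟩

/-- Correctness, class `11`. -/
theorem sol11_correct (J : LocalMap 3 N M) (hP : J.IsPure (rep 11)) (hM : 3 * N < 2 * M) :
    (fun p : Fin M => (sol11 (rawOf J)).getD p.val false) ∉ J.range := by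
  obtain ⟨e, fp, fq, rp, rq, hfpe, hfqe, hr, hdp, hdq, hcp, hcq⟩ := cert11_exists hP hM
  set cands := (enumT (rawOf J)).product ((enumT (rawOf J)).product (enumT (rawOf J))) with hc
  have hx₀ := (test11_iff J e fp fq).2 ⟨hfpe, hfqe, hdp, hdq, rp, rq, hr, hcp, hcq⟩
  have hmem : ((e.val, tripOf J e), (fp.val, tripOf J fp), (fq.val, tripOf J fq)) ∈ cands :=
    List.pair_mem_product.2 ⟨mem_enumT J e, List.pair_mem_product.2 ⟨mem_enumT J fp, mem_enumT J fq⟩⟩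
  cases h : cands.find? (fun x => test11 (rawOf J, x)) with
  | none => exact absurd hx₀ (by have := List.find?_eq_none.1 h _ hmem; simpa using this)
  | some x =>
    obtain ⟨xe, xp, xq⟩ := x
    have hx := List.find?_some h
    have hm := List.mem_of_find?_eq_some h
    obtain ⟨h1, h23⟩ := List.pair_mem_product.1 hm
    obtain ⟨h2, h3⟩ := List.pair_mem_product.1 h23
    obtain ⟨pe, rfl⟩ := (mem_enumT_iff J).1 h1
    obtain ⟨pp, rfl⟩ := (mem_enumT_iff J).1 h2
    obtain ⟨pq, rfl⟩ := (mem_enumT_iff J).1 h3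
    obtain ⟨hpe, hqe, hdp', hdq', rp', rq', hr', hcp', hcq'⟩ := (test11_iff J pe pp pq).1 hx
    have hsol : sol11 (rawOf J) = coindic M [pp.val, pq.val] := by unfold sol11; rw [← hc, h]; rfl
    have hsq : row7 J pq ∈ Submodule.span (ZMod 2) (row7 J '' {f | f ≠ pp ∧ f ≠ pq}) := by
      have := row7_mem_span_of_dep hdq' hdp'
      have e : {f : Fin M | f ≠ pq ∧ f ≠ pp} = {f | f ≠ pp ∧ f ≠ pq} := by ext f; simp only [Set.mem_setOf_eq]; tauto
      rw [e] at this; exact this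
    refine cert11_sound hP hpe hqe hr' hcp' hcq' (row7_mem_span_of_dep hdp' hdq') hsq fun f => ?_
    show (sol11 (rawOf J)).getD f.val false = false ↔ _
    rw [hsol, coindic_at]
    simp only [Bool.not_eq_false', decide_eq_true_eq, List.mem_cons, List.not_mem_nil, or_false,
      Fin.ext_iff]

/-- `coordL` is polynomial time, for each fixed role. -/
theorem codeFP_coordL (r : ℕ) : CodeFP etE natE (fun x => coordL x r) := by
  unfold coordL
  by_cases h0 : r = 0
  · simp only [h0, if_true]; exact (snd _ _).fst'
  · by_cases h1 : r = 1
    · simp only [h1, if_true]; exact (snd _ _).snd'.fst'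
    · simp only [h0, h1, if_false]; exact (snd _ _).snd'.snd'

/-- The roles test is polynomial time. -/
theorem codeFP_roles11 : CodeFP (pairE etE (pairE etE etE)) bitE (fun x => roles11 x.1 x.2.1 x.2.2) := by
  have m : ∀ r : ℕ, CodeFP (pairE etE (pairE etE etE)) bitE (fun x => memb3 (coordL x.1 r, x.2.1)) :=
    fun r => codeFP_memb3.comp (((codeFP_coordL r).comp (fst _ _)).pair (snd _ _).fst')
  have m' : ∀ r : ℕ, CodeFP (pairE etE (pairE etE etE)) bitE (fun x => memb3 (coordL x.1 r, x.2.2)) :=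
    fun r => codeFP_memb3.comp (((codeFP_coordL r).comp (fst _ _)).pair (snd _ _).snd')
  exact ((((((((m 0).and (m' 1)).or ((m 0).and (m' 2))).or ((m 1).and (m' 0))).or ((m 1).and (m' 2))).or
    ((m 2).and (m' 0))).or ((m 2).and (m' 1))).congr fun _ => rfl)

/-- Polynomial time, class `11`. -/
theorem codeFP_sol11 : CodeFP prE (rawE bitE) sol11 := by
  have hc : CodeFP prE (rawE (pairE etE (pairE etE etE)))
      (fun pr => (enumT pr).product ((enumT pr).product (enumT pr))) :=
    (rawProduct _ _).comp (codeFP_enumT.pair ((rawProduct _ _).comp (codeFP_enumT.pair codeFP_enumT)))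
  have hN : CodeFP (pairE prE etE) unE (fun q => q.1.1) := (fst _ _).fst'
  have htPS : CodeFP (pairE prE etE) bitE (testPS r7) := by
    have hrows : CodeFP (pairE prE etE) (rawE (rawE natE)) (fun q => (q.1.2.2.take q.2.1).map r7) :=
      (map₀ codeFP_r7).comp ((rawTakeNat tripE).comp ((snd _ _).fst'.pair (fst _ _).snd'.snd'))
    exact (codeFP_inSpan.comp (hN.pair (hrows.pair (codeFP_r7.comp (snd _ _).snd')))).congr fun _ => rfl
  -- projections of `q = (pr, e, fp, fq)`
  have qpr : CodeFP (pairE prE (pairE etE (pairE etE etE))) prE (fun q => q.1) := fst _ _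
  have qe : CodeFP (pairE prE (pairE etE (pairE etE etE))) etE (fun q => q.2.1) := (snd _ _).fst'
  have qp : CodeFP (pairE prE (pairE etE (pairE etE etE))) etE (fun q => q.2.2.1) := (snd _ _).snd'.fst'
  have qq : CodeFP (pairE prE (pairE etE (pairE etE etE))) etE (fun q => q.2.2.2) := (snd _ _).snd'.snd'
  have ht : CodeFP (pairE prE (pairE etE (pairE etE etE))) bitE test11 :=
    ((((codeFP_eqTest qp.fst' qe.fst').not.and (codeFP_eqTest qq.fst' qe.fst').not).and
      ((htPS.comp (qpr.pair qp)).and (htPS.comp (qpr.pair qq)))).and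
      (codeFP_roles11.comp (snd _ _))).congr fun _ => rfl
  have hro : CodeFP (pairE etE (pairE etE etE)) (rawE natE) (fun x => [x.2.1.1, x.2.2.1]) :=
    ((rawCons natE).comp ((snd _ _).fst'.fst'.pair ((rawSingleton natE).comp (snd _ _).snd'.fst'))).congr
      fun _ => rfl
  exact (codeFP_cosearchOutCtx hc ht hro).congr fun pr => by unfold sol11; rfl

end Summit.PneNP.PneNP.Theorems.Nc03Reduction
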